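import Literature.ComputerArithmetic.Shewchuk1997.Compress
import Mathlib.Tactic.Linarith
import Mathlib.Tactic.Positivity
import Mathlib.Tactic.Ring
import Mathlib.Tactic.NormNum

/-!
# COMPRESS, second traversal: the carry stays below the ulp of the next carry (new work)

New work of the certified-arithmetic venture (ENGINES group: shared numerical engines serving
client cells; rigour lives in the verifiers; every published number belongs to a client cell's
ledger, not to the engines group), part 2 of 3 of the proof of the sharp error bound for the largest
component of Shewchuk's COMPRESS [Shewchuk1997, §2.7, Theorem 23 and the conjecture on p. 333]
(part 1 `CompressSharpStair.lean`, part 3 `CompressTopError.lean`), over the tree's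
formalisation `Literature/ComputerArithmetic/Shewchuk1997/Compress.lean` (`compressUp`, `UpInv`,
`UStair`).

THE SECOND TRAVERSAL of COMPRESS (Theorem 23, Lines 10–16) adds the first traversal's components,
smallest first, into a carry `Q`, emitting the nonzero roundoffs below it.  THIS FILE
(`compressUp_carry_lt_ulp`): in an EMITTING step — carry `Q` with `|Q| ≤ ulp g`, the components
`rs` emitted so far summing to less than `ulp Q` (the tree's `UpInv`), next component `g` with
`|g| ≥ 2^(emin+p)`, NONZERO roundoff `g + Q − fl(g + Q)` — the old carry lies STRICTLY below the
ulp of the new one: `|Q| < ulp(fl(g + Q))`, provided the stair under `g` is sharp in the sense of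
part 1 (assumed here as a hypothesis about `g`, `Q`, `rs` alone).  Proof: if `fl(g + Q)` keeps the
binade of `g` the claim is `|Q| < ulp g`, where equality would put `g + Q` on the grid of `ulp g`
inside the float range, i.e. make it a float with zero roundoff.  The binade can only be lost when
`|g| = 2^j` exactly (`g` is normal and on the grid `ulp g`; any other `g` keeps
`|g + Q| ≥ |g| − ulp g ≥ 2^j`) and `Q` points towards zero; then so does `Q + Σ rs`
(`|Σ rs| < ulp Q ≤ |Q|`), the sharp stair gives `|Q + Σ rs| < ulp(g)/2`, which on the grid of
`ulp Q` forces `|Q| ≤ ulp(g)/2`, equality being excluded by representability again (`g + Q` would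
lie on the grid `ulp(g)/2` strictly below `2^j`); and `|g + Q| ≥ 2^j − ulp(g)/2 ≥ 2^(j−1)` keeps
`ulp(fl(g + Q)) ≥ ulp(g)/2 > |Q|`.

Also proved here for part 3: in a list of NONZERO floats each lying 1-below its predecessors, the
tail sums to less than the head in magnitude (`abs_sum_tail_lt_head`).

References: J. R. Shewchuk, Discrete Comput. Geom. 18 (1997) 305–363, §2.7 [Shewchuk1997]; ulp and
roundings as in Boldo–Jeannerod–Melquiond–Muller, ACM Comput. Surv. 55 (2023), §2 [BoldoEtAl2023].
-/

namespace Summit.Ventures.CertifiedArithmetic.Expansions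

open Literature.ComputerArithmetic.JeannerodRump2018
open Literature.ComputerArithmetic.BoldoJeannerodMelquiondMuller2023 hiding twoSum twoSum_fst
open Literature.ComputerArithmetic.JoldesMullerPopescu2017 (ulp_le_of_abs_lt_two_zpow)
open Literature.ComputerArithmetic.GraillatMuller2025 (ulp_two_zpow)
open Literature.ComputerArithmetic.Shewchuk1997

variable {p : ℕ} {emin : ℤ} {fl : ℚ → ℚ}

/-- Powers of two at or above `2^emin` are floats (`p ≥ 1`). -/
private theorem isFloat_zpow (hp : 1 ≤ p) {k : ℤ} (hk : emin ≤ k) : IsFloat p emin ((2 : ℚ) ^ k) :=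
  ⟨1, k, by rw [abs_one]; exact one_lt_pow₀ (by norm_num) (by omega), hk, by simp⟩

/-- In a list of NONZERO floats each lying 1-below the ones before it, the tail sums to less than
the head in magnitude; in particular the whole list does not sum to zero. -/
theorem abs_sum_tail_lt_head {r : ℚ} {tail : List ℚ} (hF : ∀ h ∈ r :: tail, IsFloat p emin h)
    (hpw : (r :: tail).Pairwise (fun a b => Below 1 b a)) (hne : ∀ h ∈ r :: tail, h ≠ 0) :
    |tail.sum| < |r| := by
  have hr0 : r ≠ 0 := hne r (by simp)
  cases tail with
  | nil => simpa using abs_pos.mpr hr0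
  | cons r' tl =>
    obtain ⟨hbr, hpw'⟩ := List.pairwise_cons.mp hpw
    have hr'0 : r' ≠ 0 := hne r' (by simp)
    obtain ⟨s, -, hsr, hr's⟩ := (hbr r' (by simp)).normalize (hF r (by simp))
    rw [one_mul] at hr's
    have hle : ∀ h ∈ r' :: tl, |h| ≤ |r'| := by
      intro h hh
      rcases List.mem_cons.mp hh with rfl | hh
      · exact le_rfl
      · exact (((List.pairwise_cons.mp hpw').1 h hh).abs_lt le_rfl hr'0).le
    have hexp : IsExpansion 1 (r' :: tl).reverse := List.pairwise_reverse.mpr hpw'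
    exact (abs_sum_lt_two_zpow_of_rev (fun h hh => hF h (List.mem_cons_of_mem _ hh)) hexp
      (fun h hh => (hle h hh).trans_lt hr's)).trans_le (hsr.two_zpow_le_abs hr0)

/-! ### The carry bound -/

/-- THE CARRY BOUND (the heart of the emitting step of the second traversal).  In the second traversal (Lines 10–16), let the carry `Q`
(`|Q| ≤ ulp g`, the components `rs` already emitted below it summing to less than `ulp Q`) meet the
next component `g` of the first traversal (`|g| ≥ 2^(emin+p)`) with a NONZERO roundoff
`g + Q − fl(g + Q)`.  Then the old carry lies STRICTLY below the ulp of the new one,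
`|Q| < ulp(fl(g + Q))`.  If `fl(g + Q)` keeps the binade of `g` this is `|Q| < ulp g` (equality
would make `g + Q` a float).  The binade can only be lost when `|g|` is a power of two and `Q`
points towards zero; then the SHARP STAIR gives `|Q + Σ rs| < ulp(g)/2`, whence `|Q| ≤ ulp(g)/2`
on the grid of `ulp Q`, where equality would again make `g + Q` a float; and
`ulp(fl(g + Q)) ≥ ulp(g)/2`. -/
theorem compressUp_carry_lt_ulp (hp : 2 ≤ p) (hfl : IsRoundNearest p emin fl)
    {rs : List ℚ} {Q g : ℚ} (inv : UpInv p emin 1 rs Q) (hg : IsFloat p emin g)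
    (hgbig : (2 : ℚ) ^ (emin + p) ≤ |g|) (hQg : |Q| ≤ ulp p emin g)
    (hq : g + Q - fl (g + Q) ≠ 0)
    (hsharp : (∃ j : ℤ, emin + p ≤ j ∧ |g| = 2 ^ j) → g * (Q + rs.sum) < 0 →
      |Q + rs.sum| < ulp p emin g / 2) :
    |Q| < ulp p emin (fl (g + Q)) := by
  have hp1 : 1 ≤ p := le_trans (by norm_num) hp
  have h2ne : (2 : ℚ) ≠ 0 := by norm_num
  have hg0 : g ≠ 0 := by
    intro h; rw [h, abs_zero] at hgbig
    exact absurd hgbig (not_le.mpr (zpow_pos (by norm_num) _))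
  have hnf : ¬ IsFloat p emin (g + Q) := fun hf => hq (by rw [fl_eq_self hfl hf, sub_self])
  obtain ⟨m, hm, hM⟩ := exists_ulp_eq_two_zpow (p := p) (emin := emin) g
  -- `|g| < 2^(m+p)`, so `m ≥ emin + 1`
  have hg_lt : |g| < (2 : ℚ) ^ (m + p) := by
    have h := abs_lt_two_pow_mul_ulp (p := p) (emin := emin) g
    rw [hM] at h
    calc |g| < 2 ^ p * (2 : ℚ) ^ m := h
      _ = (2 : ℚ) ^ (m + p) := by rw [← zpow_natCast, ← zpow_add₀ h2ne, add_comm]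
  have hm1 : emin + 1 ≤ m := by
    by_contra h
    have hme : m = emin := le_antisymm (by omega) hm
    rw [hme] at hg_lt
    linarith
  have hmg : OnGrid m g := onGrid_of_two_zpow_le_ulp hg (by rw [hM])
  -- (A) `|Q| < ulp g`: equality would put `g + Q` on the grid of `ulp g` inside the float range
  have hQlt : |Q| < (2 : ℚ) ^ m := by
    rw [hM] at hQg
    rcases hQg.lt_or_eq with h | h
    · exact h
    · exfalso
      have hmQ : OnGrid m Q := by
        rcases (abs_eq (zpow_pos (by norm_num : (0 : ℚ) < 2) m).le).mp h with h' | h'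
        · rw [h']; exact OnGrid.two_zpow le_rfl
        · rw [h']; exact (OnGrid.two_zpow le_rfl).neg
      have hge : (2 : ℚ) ^ (m + p) ≤ |g + Q| :=
        two_zpow_le_abs_of_onGrid_of_not_isFloat hm (hmg.add hmQ) hnf
      have hgle : |g| ≤ (2 : ℚ) ^ (m + p) - (2 : ℚ) ^ (m + p - p) :=
        abs_le_sub_of_abs_lt_two_zpow hp1 hg hg_lt
      rw [show m + p - p = m by ring] at hgle
      have heq : |g + Q| = (2 : ℚ) ^ (m + p) :=
        le_antisymm (by linarith [abs_add_le g Q]) hge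
      apply hnf
      rcases (abs_eq (zpow_pos (by norm_num : (0 : ℚ) < 2) _).le).mp heq with h' | h'
      · rw [h']; exact isFloat_zpow hp1 (by omega)
      · rw [h']; exact (isFloat_zpow hp1 (by omega)).neg
  rcases le_or_gt (ulp p emin g) (ulp p emin (fl (g + Q))) with hle | hlt
  · -- no binade is lost
    rw [hM] at hle; exact hQlt.trans_le hle
  · -- the new carry lies in a lower binade than `g`: `|fl (g + Q)| < |g|`, `|g + Q| < |g|`
    have hQn_lt_g : |fl (g + Q)| < |g| := by
      by_contra h; rw [not_lt] at h; exact absurd (ulp_mono h) (not_le.mpr hlt)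
    have hgQ_lt : |g + Q| < |g| := by
      by_contra h; rw [not_lt] at h
      exact absurd (abs_le_abs_fl hfl hg h) (not_le.mpr hQn_lt_g)
    -- `g` is normal with `ulp g = 2^m`: `2^(m+p-1) ≤ |g|`
    have hglow : (2 : ℚ) ^ (m + p - 1) ≤ |g| := by
      have hnorm : (2 : ℚ) ^ (emin + p - 1) ≤ |g| :=
        le_trans (zpow_le_zpow_right₀ (by norm_num) (by omega)) hgbig
      have h1 := ulp_le_of_normal hp1 hnorm
      rw [hM, le_div_iff₀ (by positivity)] at h1
      calc (2 : ℚ) ^ (m + p - 1) = (2 : ℚ) ^ m * 2 ^ (p - 1) := by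
            rw [← zpow_natCast, Nat.cast_sub hp1, ← zpow_add₀ h2ne]
            congr 1; push_cast; ring
        _ ≤ |g| := h1
    -- and `|g|` is EXACTLY `2^(m+p-1)`: otherwise `|g + Q| > |g| − 2^m ≥ 2^(m+p-1)` keeps the binade
    have hgeq : |g| = (2 : ℚ) ^ (m + p - 1) := by
      by_contra hne
      have hgt : (2 : ℚ) ^ (m + p - 1) < |g| := lt_of_le_of_ne hglow (Ne.symm hne)
      have hge : (2 : ℚ) ^ (m + p - 1) + (2 : ℚ) ^ m ≤ |g| :=
        (OnGrid.two_zpow (by omega : m ≤ m + p - 1)).add_two_zpow_le hmg.abs hgt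
      have h3 : (2 : ℚ) ^ (m + p - 1) ≤ |g + Q| := by
        have := abs_add_le (g + Q) (-Q)
        rw [abs_neg, add_neg_cancel_right] at this
        linarith
      have hf : IsFloat p emin ((2 : ℚ) ^ (m + p - 1)) := isFloat_zpow hp1 (by omega)
      have h4 : (2 : ℚ) ^ (m + p - 1) ≤ |fl (g + Q)| := by
        have := abs_le_abs_fl hfl hf (show |(2 : ℚ) ^ (m + p - 1)| ≤ |g + Q| by
          rw [abs_of_pos (zpow_pos (by norm_num) _)]; exact h3)
        rwa [abs_of_pos (zpow_pos (by norm_num : (0 : ℚ) < 2) _)] at this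
      have h5 : (2 : ℚ) ^ m ≤ ulp p emin (fl (g + Q)) := by
        have := ulp_mono (p := p) (emin := emin)
          (show |(2 : ℚ) ^ (m + p - 1)| ≤ |fl (g + Q)| by
            rw [abs_of_pos (zpow_pos (by norm_num) _)]; exact h4)
        rwa [ulp_two_zpow (by omega : emin ≤ (m + p - 1) - p + 1),
          show m + p - 1 - p + 1 = m by ring] at this
      rw [hM] at hlt
      exact absurd h5 (not_le.mpr hlt)
    -- `Q ≠ 0` points against `g`, and so does `Q + Σ rs` (`|Σ rs| < ulp Q ≤ |Q|`)
    have hQ0 : Q ≠ 0 := by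
      intro h; apply hnf; rw [h, add_zero]; exact hg
    have hrs_lt : |rs.sum| < |Q| := inv.sum_lt.trans_le (ulp_le_abs_of_isFloat inv.hQ hQ0)
    have hsgn : g * (Q + rs.sum) < 0 := by
      rcases lt_or_gt_of_ne hg0 with hgneg | hgpos
      · have hQpos : 0 < Q := by
          by_contra h; rw [not_lt] at h
          rw [abs_of_nonpos (by linarith : g + Q ≤ 0), abs_of_neg hgneg] at hgQ_lt
          linarith
        have : 0 < Q + rs.sum := by
          rw [abs_of_pos hQpos] at hrs_lt; linarith [neg_abs_le rs.sum]
        exact mul_neg_of_neg_of_pos hgneg this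
      · have hQneg : Q < 0 := by
          by_contra h; rw [not_lt] at h
          rw [abs_of_nonneg (by linarith : 0 ≤ g + Q), abs_of_pos hgpos] at hgQ_lt
          linarith
        have : Q + rs.sum < 0 := by
          rw [abs_of_neg hQneg] at hrs_lt; linarith [le_abs_self rs.sum]
        exact mul_neg_of_pos_of_neg hgpos this
    -- THE SHARP STAIR: `|Q + Σ rs| < ulp(g)/2 = 2^(m-1)`, so `|Q| ≤ 2^(m-1)` on the grid of `ulp Q`
    have hstair : |Q + rs.sum| < (2 : ℚ) ^ (m - 1) := by
      have := hsharp ⟨m + p - 1, by omega, hgeq⟩ hsgn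
      rw [hM, show (2 : ℚ) ^ m / 2 = (2 : ℚ) ^ (m - 1) by rw [zpow_sub_one₀ h2ne]; ring] at this
      exact this
    obtain ⟨k, hk, hK⟩ := exists_ulp_eq_two_zpow (p := p) (emin := emin) Q
    have hkQ : OnGrid k Q := by
      obtain ⟨K, hK'⟩ := exists_eq_int_mul_ulp_of_isFloat (p := p) (emin := emin) inv.hQ
      exact ⟨K, by rw [← hK]; exact hK'⟩
    have hulpQ : ulp p emin Q ≤ (2 : ℚ) ^ (m - 1) := by
      rcases le_or_gt emin (m - p) with h | h
      · exact (ulp_le_of_abs_lt_two_zpow hQlt h).trans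
          (zpow_le_zpow_right₀ (by norm_num) (by omega))
      · have hQsmall : |Q| < (2 : ℚ) ^ (emin + p - 1) :=
          hQlt.trans_le (zpow_le_zpow_right₀ (by norm_num) (by omega))
        rw [ulp_eq_of_abs_lt hQsmall]
        exact zpow_le_zpow_right₀ (by norm_num) (by omega)
    have hkm : k ≤ m - 1 :=
      (zpow_le_zpow_iff_right₀ (by norm_num : (1 : ℚ) < 2)).mp (by rw [← hK]; exact hulpQ)
    have hQle : |Q| ≤ (2 : ℚ) ^ (m - 1) :=
      abs_le_two_zpow_of_onGrid hkm hkQ (by rw [← hK]; exact inv.sum_lt) hstair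
    -- equality would again make `g + Q` a float
    have hQlt' : |Q| < (2 : ℚ) ^ (m - 1) := by
      rcases hQle.lt_or_eq with h | h
      · exact h
      · exfalso
        have hm1Q : OnGrid (m - 1) Q := by
          rcases (abs_eq (zpow_pos (by norm_num : (0 : ℚ) < 2) _).le).mp h with h' | h'
          · rw [h']; exact OnGrid.two_zpow le_rfl
          · rw [h']; exact (OnGrid.two_zpow le_rfl).neg
        have := two_zpow_le_abs_of_onGrid_of_not_isFloat (by omega : emin ≤ m - 1)
          ((hmg.mono (by omega)).add hm1Q) hnf
        rw [show m - 1 + (p : ℤ) = m + p - 1 by ring] at this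
        linarith
    -- and the new carry keeps at least the binade below: `ulp (fl (g + Q)) ≥ 2^(m-1)`
    have h3 : (2 : ℚ) ^ (m + p - 2) ≤ |g + Q| := by
      have hsub : |g| - |Q| ≤ |g + Q| := by
        have := abs_add_le (g + Q) (-Q)
        rw [abs_neg, add_neg_cancel_right] at this
        linarith
      have h22 : (2 : ℚ) ^ (m + p - 1) = 2 * (2 : ℚ) ^ (m + p - 2) := by
        rw [show m + p - 1 = (m + p - 2) + 1 by ring, zpow_add_one₀ h2ne, mul_comm]
      have h23 : (2 : ℚ) ^ (m - 1) ≤ (2 : ℚ) ^ (m + p - 2) :=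
        zpow_le_zpow_right₀ (by norm_num) (by omega)
      linarith
    have hf : IsFloat p emin ((2 : ℚ) ^ (m + p - 2)) := isFloat_zpow hp1 (by omega)
    have h4 : (2 : ℚ) ^ (m + p - 2) ≤ |fl (g + Q)| := by
      have := abs_le_abs_fl hfl hf (show |(2 : ℚ) ^ (m + p - 2)| ≤ |g + Q| by
        rw [abs_of_pos (zpow_pos (by norm_num) _)]; exact h3)
      rwa [abs_of_pos (zpow_pos (by norm_num : (0 : ℚ) < 2) _)] at this
    have h5 : (2 : ℚ) ^ (m - 1) ≤ ulp p emin (fl (g + Q)) := by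
      have := ulp_mono (p := p) (emin := emin)
        (show |(2 : ℚ) ^ (m + p - 2)| ≤ |fl (g + Q)| by
          rw [abs_of_pos (zpow_pos (by norm_num) _)]; exact h4)
      rwa [ulp_two_zpow (by omega : emin ≤ (m + p - 2) - p + 1),
        show m + p - 2 - (p : ℤ) + 1 = m - 1 by ring] at this
    exact hQlt'.trans_le h5

end Summit.Ventures.CertifiedArithmetic.Expansions
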